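import Literature.NumberTheory.PAdicHodge.DeRhamEllipticAbove
import HarnessLib

/-!
# De Rham-ness of `V_pE` ASCENDS along `K_v → K'_{v'}`: the base-change companion of `DeRhamEllipticAbove` (proofs only)

Topic `NumberTheory/PAdicHodge`; namespace `Literature.NumberTheory.PAdicHodge`. THEOREMS ONLY (no definition, no named fact, no
instance, no `sorry`). `DeRhamEllipticAbove.lean` proves the DESCENT «`V_p(W ×_K K')|_{Γ_{K'_{v'}}}` de Rham ⇒ `V_pW|_{Γ_{K_v}}` de Rham»
(potentially de Rham ⇒ de Rham, Brinon–Conrad 6.3.8). This file records the (easier) ASCENT with the same plumbing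
(`adicCompletionOfLiesOver`, `isDeRham_iff_isDeRham_restrictField`, the tower lemma `isAdmissible_restrictField_restrictField_iff`, the
base-change equivalence `rationalTateModuleEquiv`):

* ★ `isDeRham_restrictedRationalTateRep_baseChange_above_of_isDeRham` — `W/K` elliptic over a number field, `v ∣ p`, `K'/K` finite with
  `v' ∣ v`: if `V_pW|_{Γ_{K_v}}` is de Rham for `B_dR(K_v)` then `V_p(W ×_K K')|_{Γ_{K'_{v'}}}` is de Rham for `B_dR(K'_{v'})` (for ANY
  `p`-adic structures on `K'_{v'}` in scope);
* `isDeRham_restrictedRationalTateRep_baseChange_above_rat_of_isDeRham` — the same over `ℚ` with `v`, `v'` given separately as the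
  places above `p` (`LiesOver` is automatic).

Consumer: the twist transport of de Rham-ness for TDS57's cell `(5; II)` (crux `stmt-BirchSwinnertonDyer-22227`): a type-II curve at `5` is
the `5`-twist of a IV* curve, isomorphic to it over `ℚ(√5)`. BSD is not proved by any of this.

## References
* [BrinonConrad2009] O. Brinon, B. Conrad, *CMI notes on p-adic Hodge theory* (2009), Prop. 6.3.8.
* [FontaineAsterisque223III] J.-M. Fontaine, Astérisque 223 (1994), Exp. III §1.5.
-/

noncomputable section

open scoped NumberField
open Field ValuativeRel NumberField IsDedekindDomain

namespace Literature.NumberTheory.PAdicHodge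

open Literature.NumberTheory.GaloisRepresentations
open Literature.NumberTheory.GaloisRepresentations.IsNonarchimedeanLocalField
open Literature.NumberTheory.EllipticCurves WeierstrassCurve
open Literature.NumberTheory.Automorphic

/-- ★ **De Rham ASCENDS along `K_v → K'_{v'}` (base-change form).** `W/K` elliptic over a number field, `v ∣ p` a place of `K`, `K'/K`
finite with a place `v' ∣ v`; if `V_pW|_{Γ_{K_v}}` is de Rham for `B_dR(K_v)` then `V_p(W ×_K K')|_{Γ_{K'_{v'}}}` is de Rham for
`B_dR(K'_{v'})`: restriction to the open subgroup `Γ_{K'_{v'}} ⊆ Γ_{K_v}` (`isDeRham_iff_isDeRham_restrictField`), the two towers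
`K ⊆ K_v ⊆ K'_{v'}` and `K ⊆ K' ⊆ K'_{v'}` (`isAdmissible_restrictField_restrictField_iff`), and `V_p(W ×_K K') ≅ V_pW|_{Γ_{K'}}`
(`rationalTateModuleEquiv`). [cite: BrinonConrad2009, Prop. 6.3.8] [cite: FontaineAsterisque223III, Exp. III §1.5] -/
theorem isDeRham_restrictedRationalTateRep_baseChange_above_of_isDeRham
    {K : Type} [Field K] [NumberField K] (W : WeierstrassCurve K) [W.IsElliptic] {p : ℕ} [Fact p.Prime]
    {K' : Type} [Field K'] [NumberField K'] [Algebra K K']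
    (v : HeightOneSpectrum (𝓞 K)) (v' : HeightOneSpectrum (𝓞 K')) [v'.asIdeal.LiesOver v.asIdeal]
    [CharZero (v.adicCompletion K)] [Fact (¬ IsUnit (p : integerC (v.adicCompletion K)))]
    [IsAdicComplete (Ideal.span {(p : integerC (v.adicCompletion K))}) (integerC (v.adicCompletion K))]
    (hp : valuation (v.adicCompletion K) p < 1) [Algebra ℚ_[p] (v.adicCompletion K)]
    (h : GaloisRep.IsDeRham (bdRPeriodRingData (F := v.adicCompletion K) (p := p) hp)
      (restrictedRationalTateRep W (v.adicCompletion K) p))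
    [CharZero (v'.adicCompletion K')] [Fact (¬ IsUnit (p : integerC (v'.adicCompletion K')))]
    [IsAdicComplete (Ideal.span {(p : integerC (v'.adicCompletion K'))}) (integerC (v'.adicCompletion K'))]
    (hp' : valuation (v'.adicCompletion K') p < 1) [Algebra ℚ_[p] (v'.adicCompletion K')] :
    GaloisRep.IsDeRham (bdRPeriodRingData (F := v'.adicCompletion K') (p := p) hp')
      (restrictedRationalTateRep (W.baseChange K') (v'.adicCompletion K') p) := by
  letI : Algebra (v.adicCompletion K) (v'.adicCompletion K') := (adicCompletionOfLiesOver K K' v v').toAlgebra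
  haveI : IsScalarTower K (v.adicCompletion K) (v'.adicCompletion K') := isScalarTower_adicCompletionOfLiesOver v v'
  haveI : Module.Finite ℚ_[p] (W.rationalTateModule p) := W.finite_rationalTateModule p
  set 𝔅 := bdRPeriodRingData (F := v'.adicCompletion K') (p := p) hp' with h𝔅
  set ρ := W.rationalTateGaloisRep p (W.continuous_rationalGaloisRepTate_holds p) with hρ
  -- (1) ascent along `K_v → K'_{v'}`
  have h4 : 𝔅.IsAdmissible ((ρ.restrictField (v.adicCompletion K)).restrictField (v'.adicCompletion K')) :=
    (isDeRham_iff_isDeRham_restrictField (K := v.adicCompletion K) (L := v'.adicCompletion K')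
      (continuous_adicCompletionOfLiesOver K K' v v') hp hp' (restrictedRationalTateRep W (v.adicCompletion K) p)).1 h
  -- (2) towers: `K ⊆ K_v ⊆ K'_{v'}` and `K ⊆ K' ⊆ K'_{v'}`
  have h3 : 𝔅.IsAdmissible (ρ.restrictField (v'.adicCompletion K')) :=
    (GaloisRep.isAdmissible_restrictField_restrictField_iff (K₀ := K) (F₀ := v.adicCompletion K) 𝔅 ρ).1 h4
  have h2 : 𝔅.IsAdmissible ((ρ.restrictField K').restrictField (v'.adicCompletion K')) :=
    (GaloisRep.isAdmissible_restrictField_restrictField_iff (K₀ := K) (F₀ := K') 𝔅 ρ).2 h3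
  -- (3) base change `(V_pW|_{Γ_{K'}})|_{Γ_{K'_{v'}}} ≅ V_p(W_{K'})|_{Γ_{K'_{v'}}}`
  exact (𝔅.isAdmissible_iff_of_equiv ((ρ.restrictField K').restrictField (v'.adicCompletion K'))
    (restrictedRationalTateRep (W.baseChange K') (v'.adicCompletion K') p)
    (rationalTateModuleEquiv W K' p) fun σ x =>
      rationalTateModuleEquiv_rationalGaloisRepTate W K' p (absGaloisRestrict K' (v'.adicCompletion K') σ) x).1 h2

/-- **Over `ℚ`**: `V_pW|_{Γ_{ℚ_v}}` de Rham at the place `v` above `p` ⇒ `V_p(W ×_ℚ K')|_{Γ_{K'_{v'}}}` de Rham at every place `v'` of a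
number field `K'` above `p` (`v'` lies over `v` automatically). [cite: BrinonConrad2009, Prop. 6.3.8] -/
theorem isDeRham_restrictedRationalTateRep_baseChange_above_rat_of_isDeRham
    (W : WeierstrassCurve ℚ) [W.IsElliptic] {p : ℕ} [Fact p.Prime]
    {K' : Type} [Field K'] [NumberField K'] (v' : HeightOneSpectrum (𝓞 K')) (hv' : (p : 𝓞 K') ∈ v'.asIdeal)
    (v : HeightOneSpectrum (𝓞 ℚ)) (hv : (p : 𝓞 ℚ) ∈ v.asIdeal)
    [CharZero (v.adicCompletion ℚ)] [Fact (¬ IsUnit (p : integerC (v.adicCompletion ℚ)))]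
    [IsAdicComplete (Ideal.span {(p : integerC (v.adicCompletion ℚ))}) (integerC (v.adicCompletion ℚ))]
    (hp : valuation (v.adicCompletion ℚ) p < 1) [Algebra ℚ_[p] (v.adicCompletion ℚ)]
    (h : GaloisRep.IsDeRham (bdRPeriodRingData (F := v.adicCompletion ℚ) (p := p) hp)
      (restrictedRationalTateRep W (v.adicCompletion ℚ) p))
    [CharZero (v'.adicCompletion K')] [Fact (¬ IsUnit (p : integerC (v'.adicCompletion K')))]
    [IsAdicComplete (Ideal.span {(p : integerC (v'.adicCompletion K'))}) (integerC (v'.adicCompletion K'))]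
    (hp' : valuation (v'.adicCompletion K') p < 1) [Algebra ℚ_[p] (v'.adicCompletion K')] :
    GaloisRep.IsDeRham (bdRPeriodRingData (F := v'.adicCompletion K') (p := p) hp')
      (restrictedRationalTateRep (W.baseChange K') (v'.adicCompletion K') p) := by
  have hpr : (p : ℕ).Prime := Fact.out
  haveI : v'.asIdeal.LiesOver (v'.under (𝓞 ℚ)).asIdeal := liesOver_under v'
  have hv₀ : (p : 𝓞 ℚ) ∈ (v'.under (𝓞 ℚ)).asIdeal := (natCast_mem_asIdeal_iff_of_liesOver (v'.under (𝓞 ℚ)) v' p).1 hv'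
  have hvw : v = v'.under (𝓞 ℚ) :=
    ((natCast_mem_asIdeal_iff_eq_primesEquiv_symm v hpr).1 hv).trans
      ((natCast_mem_asIdeal_iff_eq_primesEquiv_symm (v'.under (𝓞 ℚ)) hpr).1 hv₀).symm
  subst hvw
  -- `Algebra ℚ ℚ_v` is a subsingleton: move `h` to the instance of the number-field lemma
  rw [show (DivisionRing.toRatAlgebra : Algebra ℚ ((v'.under (𝓞 ℚ)).adicCompletion ℚ)) =
      HeightOneSpectrum.instAlgebraAdicCompletion (𝓞 ℚ) ℚ (v'.under (𝓞 ℚ)) from Subsingleton.elim _ _] at h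
  exact isDeRham_restrictedRationalTateRep_baseChange_above_of_isDeRham W (v'.under (𝓞 ℚ)) v' hp h hp'

end Literature.NumberTheory.PAdicHodge

end
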